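import Summits.QuantumFields.BalabanUV.Beta.EriceRemainderEnclosureHistoryAutonomyComparisonAgeCompositionStaticChainWindowBounds
import Summits.QuantumFields.BalabanUV.Beta.EriceRemainderEnclosureHistoryAutonomyComparisonAgeCompositionStaticChainWindowMass

/-!
# EriceRemainderEnclosureHistoryAutonomyComparisonAgeCompositionStaticChainOuterCharges — (E74b) OUTER CHARGES: the monotonicity and discretisation facts that
# make the «min-charge» bin relaxation of the budget polytope RIGOROUS and UNIFORM IN THE YOUNG AGE

Cell `pub-balaban`, β-function sub-cell, BINDER row D4 «RemainderConst leaves for Bałaban's split» (`HOME/BINDER-OWNERS.md`; owner lineage `b2b-balaban-beta-an4`;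
this file by co-owner #2 lineage `b2b-balaban-beta-d4-p2`, generation 65), β-FLOW TEAM duty (1), FREEZE (0) honoured (def-free; imports (E72d) `…StaticChainWindowBounds`
for `le_readWindow_ratio` ∕ `readWindow_le_ratio` and (E74a) `…StaticChainWindowMass` for `readWindow_mono_left`, used BY NAME; the window read is written exactly as in (E65a), `S_{k,j} = Σ_{l<j} √(k∕(k+l+1))`).

HONEST FRAMING (page 1, verbatim and binding).  *"Discharging BetaPertH makes Bałaban's UV stability UNCONDITIONAL — a real constructive-QFT result; it is
NOT the continuum limit and NOT the Clay problem."*  THIS FILE DISCHARGES NOTHING OF THE KIND.  Elementary real inequalities about the window read of the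
census's own budget polytope — hypotheses of a census, not facts; the form, signs, ages and moments of Bałaban's (1.22) limit functional are NOT PRINTED ([I] p. 298;
GAPS G-t4-U2-1∕-2) and NOT asserted.  Row D4 class UNCHANGED (critical-path width 0; instance 0∕1; D4 DISCHARGE NO DATE).  HONEST DEPENDENCY: continuum YM on T⁴ ⇐
BetaPertH ∧ nine spine estimates (0/9 proved); BetaPertH ⇐ (D1) ∧ (D4) ∧ CAP+tail; G-an2-4 gates asym, D1 and NE2/3/4.

THE POINT (census sense (α); route (N); READMEs `g64/e73` §4 and `g65/e74` §4–§6).  The BIN-CHAIN MAJORANT bounds the young's maximal feasible load from ABOVE by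
charging every older age of a ratio bin `a ≤ k ≤ b` on every scale `j` with the SMALLEST charge in the bin («outer polytope»).  With the window-mass chain of (E74a)
this majorant is finite and closing (README g65/e74 §4: `sup Φ_ρ ≈ 0.70–0.71`, `sup Φ_T ≈ 0.20–0.22` at N = 40–80 bins per five octaves), so its rigour matters:
§1 **`charge_over_age_antitone`** — `S_{k,j}∕k` is non-increasing in the age `k > 0` (summands `1∕√(k(k+l+1))`); §2 **`charge_over_scale_mono`** — `S_{k,j}∕j` is
non-decreasing in `k`; §3 **`min_edge_charge_le`** — the charge `c_j(k) = S_{k,j}∕max(k,j)` of (E65a) is unimodal in `k`, so on a bin `min(c_j(a), c_j(b)) ≤ c_j(k)`: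
THE OUTER CHARGE IS AN EDGE CHARGE; **`young_max_load_antitone`** — smaller charges only enlarge the young's feasible load `(½ − Σ c_i x_i)∕d` (outer ⊇ true);
§4 **`readWindow_ge_continuum_sub_one`** — `2k(√(1+j∕k) − 1) − 1 ≤ S_{k,j} ≤ 2k(√(1+j∕k) − 1)` ((E72d) two-sided bracket + `2k(√(1+1∕k) − 1) ≤ 1`), and the ratio
forms `charge_over_age_continuum`, `charge_over_scale_continuum`: every charge of an age `k = r·y` on a scale `j = σ·y` is within `1∕(y·max(r,σ))` BELOW its
RATIO-ONLY continuum value `2r(√(1+σ∕r) − 1)∕max(r,σ)` — so ONE table of outer charges in the ratio variables serves every young age `y ≥ y₀` at the price `1∕y₀`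
per coefficient (the small young ages `y < y₀` keep exact charges; they are the perturbative regime, README g65 §3).  The other outer constants of the majorant are
monotone by lemmas already in the tree: defects `θ̄(k'∕k)` by (E72c) `thetabar_antitone`, window-mass weights `k∕k'` trivially, per-bin compounding by (E73a)–(E73c).
NOT CLAIMED: the composition theorem of the bin-chain majorant (bookkeeping over (E72a)∕(E73a–c)); any certified supremum; the static closure; MONO; (E58′);
anything nonlinear; anything printed.
-/
noncomputable section
open Finset

namespace Summit.QuantumFields.BalabanUV.Beta.EriceRemainderEnclosureHistoryAutonomyComparisonAgeCompositionStaticChainOuterCharges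

open Summit.QuantumFields.BalabanUV.Beta.EriceRemainderEnclosureHistoryAutonomyComparisonAgeCompositionStaticChainWindowBounds
  (le_readWindow_ratio readWindow_le_ratio)
open Summit.QuantumFields.BalabanUV.Beta.EriceRemainderEnclosureHistoryAutonomyComparisonAgeCompositionStaticChainWindowMass
  (sqrt_summand_mono readWindow_mono_left)

/-! ## §1 The charge of an age on a YOUNGER scale, `S_{k,j}∕k`, is non-increasing in the age -/

/-- Summand form: `√(k∕(k+l+1))∕k` is non-increasing in `k > 0` (it equals `1∕√(k(k+l+1))`). [folklore] -/
theorem sqrt_summand_div_antitone {k k' : ℝ} (hk : 0 < k) (hkk : k ≤ k') (l : ℕ) :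
    Real.sqrt (k' / (k' + l + 1)) / k' ≤ Real.sqrt (k / (k + l + 1)) / k := by
  have hk' : 0 < k' := lt_of_lt_of_le hk hkk
  have hl : (0 : ℝ) ≤ l := Nat.cast_nonneg l
  have hL : Real.sqrt (k' / (k' + l + 1)) / k' = Real.sqrt (1 / (k' * (k' + l + 1))) := by
    rw [eq_comm, Real.sqrt_eq_iff_mul_self_eq_of_pos (by positivity)]
    · rw [div_mul_div_comm, Real.mul_self_sqrt (by positivity)]
      field_simp
  have hR : Real.sqrt (k / (k + l + 1)) / k = Real.sqrt (1 / (k * (k + l + 1))) := by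
    rw [eq_comm, Real.sqrt_eq_iff_mul_self_eq_of_pos (by positivity)]
    · rw [div_mul_div_comm, Real.mul_self_sqrt (by positivity)]
      field_simp
  rw [hL, hR]
  apply Real.sqrt_le_sqrt
  exact one_div_le_one_div_of_le (by positivity) (by nlinarith)

/-- **`S_{k,j}∕k` IS NON-INCREASING IN THE AGE `k`** (charge of an age `k ≥ j` on the scale `j`; also the window-read weight `S_{k,y}∕k` of an older age on a
young age `y`): the OUTER (rigorous-direction) charge of a ratio bin above the scale is attained at its TOP edge. [folklore] -/
theorem charge_over_age_antitone {k k' : ℝ} (hk : 0 < k) (hkk : k ≤ k') (j : ℕ) :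
    (∑ l ∈ range j, Real.sqrt (k' / (k' + l + 1))) / k' ≤ (∑ l ∈ range j, Real.sqrt (k / (k + l + 1))) / k := by
  rw [sum_div, sum_div]
  exact sum_le_sum fun l _ => sqrt_summand_div_antitone hk hkk l

/-! ## §2 The charge of an age on an OLDER scale, `S_{k,j}∕j`, is non-decreasing in the age -/

/-- **`S_{k,j}∕j` IS NON-DECREASING IN THE AGE `k`** (charge of an age `k ≤ j` on the scale `j`): the outer charge of a ratio bin below the scale is attained at
its BOTTOM edge ((E74a) `readWindow_mono_left`, divided by the scale). [folklore] -/
theorem charge_over_scale_mono {k k' : ℝ} (hk : 0 ≤ k) (hkk : k ≤ k') (j : ℕ) (hj : (0 : ℝ) < j) :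
    (∑ l ∈ range j, Real.sqrt (k / (k + l + 1))) / j ≤ (∑ l ∈ range j, Real.sqrt (k' / (k' + l + 1))) / j :=
  div_le_div_of_nonneg_right (readWindow_mono_left hk hkk j) hj.le

/-! ## §3 The OUTER CHARGE of a bin is the minimum over its two edges -/

/-- **OUTER CHARGES ARE EDGE CHARGES.**  The charge of an age `k` on the scale `j ≥ 1` is `c_j(k) = S_{k,j}∕max(k,j)` ((E65a)); on a bin `a ≤ k ≤ b` (`a > 0`) it is
unimodal (non-decreasing below `j`, non-increasing above), so **`min(c_j(a), c_j(b)) ≤ c_j(k)`** — the rigorous («min-charge», outer-polytope) coefficient of a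
ratio bin in the bin-chain majorant of README g64/e73 §4 ∕ g65/e74 §4 is the smaller of its two edge charges. [folklore] -/
theorem min_edge_charge_le {a b k : ℝ} {j : ℕ} (hj : 1 ≤ j) (ha : 0 < a) (hak : a ≤ k) (hkb : k ≤ b) :
    min ((∑ l ∈ range j, Real.sqrt (a / (a + l + 1))) / max a (j : ℝ))
        ((∑ l ∈ range j, Real.sqrt (b / (b + l + 1))) / max b (j : ℝ)) ≤
      (∑ l ∈ range j, Real.sqrt (k / (k + l + 1))) / max k (j : ℝ) := by
  have hjr : (0 : ℝ) < j := by exact_mod_cast hj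
  have hk : 0 < k := lt_of_lt_of_le ha hak
  by_cases hkj : k ≤ (j : ℝ)
  · -- below the scale: compare with the bottom edge
    have haj : a ≤ (j : ℝ) := hak.trans hkj
    rw [max_eq_right hkj, max_eq_right haj]
    exact (min_le_left _ _).trans (charge_over_scale_mono ha.le hak j hjr)
  · -- above the scale: compare with the top edge
    have hkj' : (j : ℝ) ≤ k := (not_le.mp hkj).le
    have hbj : (j : ℝ) ≤ b := hkj'.trans hkb
    rw [max_eq_left hkj', max_eq_left hbj]
    exact (min_le_right _ _).trans (charge_over_age_antitone hk hkb j)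

/-- **THE YOUNG'S MAXIMAL LOAD IS ANTITONE IN THE CHARGES** (one scale): with usage coefficients `c'_i ≤ c_i` on loads `x_i ≥ 0` and the young's own
coefficient `d > 0`, `(½ − Σ c_i x_i)∕d ≤ (½ − Σ c'_i x_i)∕d` — replacing every older age's charge by its bin's outer charge can only ENLARGE the young's
feasible load (and the feasible set), i.e. the outer polytope contains the true one. [folklore] -/
theorem young_max_load_antitone {ι : Type*} (I : Finset ι) (c c' x : ι → ℝ) {d : ℝ} (hd : 0 < d)
    (hcc : ∀ i ∈ I, c' i ≤ c i) (hx : ∀ i ∈ I, 0 ≤ x i) :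
    (1 / 2 - ∑ i ∈ I, c i * x i) / d ≤ (1 / 2 - ∑ i ∈ I, c' i * x i) / d := by
  apply div_le_div_of_nonneg_right _ hd.le
  have := sum_le_sum fun i hi => mul_le_mul_of_nonneg_right (hcc i hi) (hx i hi)
  linarith

/-! ## §4 Discretisation: every charge is within `1∕max(k,j)` of its continuum (ratio-only) value -/

/-- `2k(√(1 + 1∕k) − 1) ≤ 1` for `k > 0` (`√(1+u) ≤ 1 + u∕2`). [folklore] -/
theorem two_mul_sqrt_one_add_inv_sub_le {k : ℝ} (hk : 0 < k) : 2 * k * (Real.sqrt (1 + 1 / k) - 1) ≤ 1 := by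
  have h1 : Real.sqrt (1 + 1 / k) ≤ 1 + 1 / (2 * k) := by
    rw [Real.sqrt_le_left (by positivity)]
    have : (1 + 1 / (2 * k)) ^ 2 = 1 + 1 / k + 1 / (4 * k ^ 2) := by field_simp; ring
    rw [this]; have : 0 ≤ 1 / (4 * k ^ 2) := by positivity
    linarith
  have h2 : 2 * k * (1 / (2 * k)) = 1 := by field_simp
  nlinarith [mul_le_mul_of_nonneg_left h1 (by positivity : (0 : ℝ) ≤ 2 * k)]

/-- **THE WINDOW READ IS WITHIN ONE UNIT OF ITS CONTINUUM VALUE, FROM BELOW**: `2k(√(1 + j∕k) − 1) − 1 ≤ S_{k,j} (≤ 2k(√(1 + j∕k) − 1))` for `k > 0` — from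
(E72d) `le_readWindow_ratio` ∕ `readWindow_le_ratio` and `√(1+(j+1)∕k) ≥ √(1+j∕k)`.  Hence the charge `c_j(k) = S_{k,j}∕max(k,j)` of an age `k = r·y` on a scale
`j = σ·y` lies in `[c^cont(r,σ) − 1∕(y·max(r,σ)), c^cont(r,σ)]` with the RATIO-ONLY `c^cont(r,σ) = 2r(√(1+σ∕r) − 1)∕max(r,σ)`: outer charges for ALL young
ages `y ≥ y₀` at once cost at most `1∕y₀` per coefficient. [folklore] -/
theorem readWindow_ge_continuum_sub_one {k : ℝ} (hk : 0 < k) (j : ℕ) :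
    2 * k * (Real.sqrt (1 + j / k) - 1) - 1 ≤ ∑ l ∈ range j, Real.sqrt (k / (k + l + 1)) ∧
    ∑ l ∈ range j, Real.sqrt (k / (k + l + 1)) ≤ 2 * k * (Real.sqrt (1 + j / k) - 1) := by
  refine ⟨?_, readWindow_le_ratio hk j⟩
  have h := le_readWindow_ratio hk j
  have hk1 : 0 ≤ 1 / k := by positivity
  have hmono : Real.sqrt (1 + j / k) ≤ Real.sqrt (1 + (j + 1) / k) :=
    Real.sqrt_le_sqrt (by rw [add_div]; linarith)
  have h1 := two_mul_sqrt_one_add_inv_sub_le hk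
  have h2 := mul_le_mul_of_nonneg_left hmono (by positivity : (0 : ℝ) ≤ 2 * k)
  nlinarith

/-- Ratio-only two-sided bound of the charge on a YOUNGER scale (`k ≥ j`, coefficient `S_{k,j}∕k`): with `r = k`-over-`j`-free letters,
`2(√(1 + j∕k) − 1) − 1∕k ≤ S_{k,j}∕k ≤ 2(√(1 + j∕k) − 1)`. [folklore] -/
theorem charge_over_age_continuum {k : ℝ} (hk : 0 < k) (j : ℕ) :
    2 * (Real.sqrt (1 + j / k) - 1) - 1 / k ≤ (∑ l ∈ range j, Real.sqrt (k / (k + l + 1))) / k ∧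
    (∑ l ∈ range j, Real.sqrt (k / (k + l + 1))) / k ≤ 2 * (Real.sqrt (1 + j / k) - 1) := by
  obtain ⟨hlo, hhi⟩ := readWindow_ge_continuum_sub_one hk j
  constructor
  · rw [le_div_iff₀ hk]
    have : (2 * (Real.sqrt (1 + j / k) - 1) - 1 / k) * k = 2 * k * (Real.sqrt (1 + j / k) - 1) - 1 := by field_simp
    linarith
  · rw [div_le_iff₀ hk]; linarith

/-- Ratio-only two-sided bound of the charge on an OLDER scale (`k ≤ j`, coefficient `S_{k,j}∕j`, `j ≥ 1`):
`(2k(√(1 + j∕k) − 1) − 1)∕j ≤ S_{k,j}∕j ≤ 2k(√(1 + j∕k) − 1)∕j`. [folklore] -/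
theorem charge_over_scale_continuum {k : ℝ} (hk : 0 < k) {j : ℕ} (hj : 1 ≤ j) :
    (2 * k * (Real.sqrt (1 + j / k) - 1) - 1) / j ≤ (∑ l ∈ range j, Real.sqrt (k / (k + l + 1))) / j ∧
    (∑ l ∈ range j, Real.sqrt (k / (k + l + 1))) / j ≤ 2 * k * (Real.sqrt (1 + j / k) - 1) / j := by
  have hjr : (0 : ℝ) < j := by exact_mod_cast hj
  obtain ⟨hlo, hhi⟩ := readWindow_ge_continuum_sub_one hk j
  exact ⟨div_le_div_of_nonneg_right hlo hjr.le, div_le_div_of_nonneg_right hhi hjr.le⟩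

end Summit.QuantumFields.BalabanUV.Beta.EriceRemainderEnclosureHistoryAutonomyComparisonAgeCompositionStaticChainOuterCharges

end
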